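/-
Copyright: the b2b-balaban cell (near-miss cell 7), T⁴-continuum fan-out, NE7b ROUND-2 swarm `t4-ne7b-formalise-*`
(seat leaf-01), row S6 «H2d zones» of lineage t4-ne7b-p1's claim table `LEAVES-NE7b.md` — TH re-target (R-OWNER-22-1).
Released under the licence of the surrounding project.
-/
import Summits.QuantumFields.BalabanUV.T4Continuum.Support.ZoneReading

/-!
# History zones along a shape map, I: the weighted crowding count and the torus multiplicity for TAGGED genealogies

Summits-side support leaf of the T⁴-continuum cell (rung (B)+1 on a FINITE torus only; NOT infinite volume, NOT the
mass gap, NOT the Clay statement; NOT a proof of the spine estimate NE7b).  NE7b ROUND-2 swarm, row S6 (H2d) after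
the owner's ruling R-OWNER-22-1 (journal l.5864): the assembly targets the TH exit
`CountThresholdExit.relWeightBound_lateMergers_of_irThreshold (sh : ε → PEv)` — a tree count over TAGGED genealogies
`G : Gen ε` read through a SHAPE MAP `sh` (tags distinct, shapes may repeat), so the (GM) multiplicity S6 owes the
socket `HistorySocketTH` (R2) — `Kz^{#merges G}·∏_{merges} Q(·,σ,step)^p·Λ′^{partnerAges}` — must be computed ON THE
TAGGED TREE.  The landed joint `ZoneCrowd` ∕ `ZoneTorusCrowd.card_admZSet_grestrict_le` ∕
`ZoneExtentLaw.card_admZSet_grestrict_le_of_dyn` is typed for `Gen PEv` (shape = identity); this file is its verbatim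
transport along an arbitrary shape map (`sh = id` recovers it; `sh = Prod.fst` is row S3's `genT`).  [folklore]
bookkeeping over the lineage's OWN carriers; nothing is quoted from print, nothing printed is asserted, no `[cite:]`
tag, no `Prop` fact minted.

WHAT.
* §1 **`wcntS sh G t`** — the weighted formation count of a tagged genealogy at step `t`: `Σ (d′+1)` over its births
  of shape-step `t` plus the number of its mergers of shape-step `t` (the tagged `CrowdingWeighted.wcnt`; rows S6e
  (surcharge) and S12 read THIS count); `disjoint_births_mergesE` (any alphabet), `sum_wt_filter_eq_wcntS`.
* §2 `qZ_le_QS`: the driver `qZ (wtPEv ∘ sh) σ (step ∘ sh)` of a dated sub-structure is at most `Q (wcntS sh G) σ t`.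
* §3 `mergeProd_qZ_rpow_leS`, `zoneFactor_le_prod_QS`: the structural product of the drivers against
  `∏_{e ∈ merges G} Q(wcntS sh G, σ, (sh e).step)^p` under `Chrono (step ∘ sh)`.
* §4 **`card_admZSet_grestrict_leS`** (the torus joint along `sh`): for `G : Gen ε` well-formed, chronological, with
  kind-`0` birth shapes and non-kind-`0` merger shapes, events in a finset `E`, and nonnegative extents under the
  affine law `ext t X ≤ C₀·qZ (wtPEv∘sh) σ (step∘sh) X t + c₀`, the zone-admissible torus placements of
  `grestrict E G hE` with the root piece at `c` number at most
  `Kz^{#merges G}·(∏_{e ∈ merges G} Q(wcntS sh G,σ,(sh e).step)^(d:ℝ))·(L^d)^{partnerAges (step∘sh) G}`,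
  `Kz = 2^d(C₀+2c₀+1)^d`; **`card_admZSet_grestrict_le_of_dynS`**: the same with the affine law REPLACED by the zone
  dynamics `ZoneExtentLaw.ZoneDyn (step ∘ sh) (wtPEv ∘ sh) σ Cb ext`, `Kz = 2^d(C₀ + 2∕(1−σ²) + 1)^d`,
  `C₀ = max Cb (1∕(1−σ²)+1)`.
* §5 sanity: `sh = Prod.fst` on a tagged chain with a REPEATED birth shape (two class-`1` regions born at step `0`) —
  the weighted count sees both (`wcntS = 4` at step `0`), where the flat image's `wcnt` would see one.

Part II (`Support/HistoryShapeZones.lean`): the zone READING along `sh` (birth regions ↦ `ZoneDyn` + admissibility)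
and the count `card_admZSet_le_of_readingS`; part III binds row S3's `genT`.  Walls unchanged: (ID) G-ne7bp1g9-1 (H3,
displayed), (E2)∕(R1) G-ne7bp1-1.  NE7b discharge: no date.

HONEST DEPENDENCY (cell): continuum YM on T⁴ ⇐ BetaPertH ∧ nine spine estimates (0/9 proved); BetaPertH ⇐ (D1) ∧ (D4)
∧ CAP+tail; G-an2-4 gates asym, D1 and NE2/3/4.  This file changes none of it.
-/

open Finset
open Literature.MathematicalPhysics.QuantumFieldTheory.Balaban1983to89
open T4PersistenceDictionary T4PartnerMultiplicity
open Summit.QuantumFields.BalabanUV.T4Continuum.PlacementSkeleton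
open Summit.QuantumFields.BalabanUV.T4Continuum.Crowding
open Summit.QuantumFields.BalabanUV.T4Continuum.ZoneSkeleton
open Summit.QuantumFields.BalabanUV.T4Continuum.ZoneCrowd
open Summit.QuantumFields.BalabanUV.T4Continuum.ZoneTorus

namespace Summit.QuantumFields.BalabanUV.T4Continuum.HistoryZones

noncomputable section

variable {ε : Type*} [DecidableEq ε] (sh : ε → PEv) (W : ε → ℕ)

/-! ## §1 The weighted formation count of a tagged genealogy -/

/-- **THE WEIGHTED FORMATION COUNT ALONG A SHAPE MAP**: at step `t`, the births of `G` whose shape is dated `t` weigh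
`d′ + 1` each, the mergers whose shape is dated `t` weigh `1` each (the tagged `CrowdingWeighted.wcnt`). [folklore] -/
def wcntS (G : Gen ε) (t : ℕ) : ℕ :=
  ∑ b ∈ (births G).filter (fun b => (sh b).step = t), ((sh b).fat + 1) +
    ((merges G).filter fun m => (sh m).step = t).card

/-- under well-formedness the births and the mergers are disjoint (any alphabet) [folklore] -/
theorem disjoint_births_mergesE : ∀ {G : Gen ε}, G.WF W → Disjoint (births G) (merges G)
  | Gen.born b j, _ => by simp [merges]
  | Gen.renew G e h, hW => by simpa [merges] using disjoint_births_mergesE (G := G) hW.1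
  | Gen.merge X Y e, hW => by
      obtain ⟨heX, heY, hdM, hdB⟩ := merge_facts W hW
      have hXe : e ∉ births X := fun h => hW.2.2.1 (births_subset_events X h)
      have hYe : e ∉ births Y := fun h => hW.2.2.2.1 (births_subset_events Y h)
      have hXY : Disjoint (births X) (merges Y) :=
        hW.2.2.2.2.1.mono (births_subset_events X) (merges_subset_events Y)
      have hYX : Disjoint (births Y) (merges X) :=
        (hW.2.2.2.2.1.mono (merges_subset_events X) (births_subset_events Y)).symm
      rw [births_merge, merges, disjoint_insert_right, mem_union, disjoint_union_left, disjoint_union_right,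
        disjoint_union_right]
      exact ⟨fun h => h.elim hXe hYe, ⟨disjoint_births_mergesE hW.1, hXY⟩, ⟨hYX, disjoint_births_mergesE hW.2.1⟩⟩

/-- **THE WEIGHTED COUNT OF THE FORMATION EVENTS OF SHAPE-STEP `s` IS `wcntS`.** [folklore] -/
theorem sum_wt_filter_eq_wcntS {G : Gen ε} (hW : G.WF W) (hk0 : ∀ b ∈ births G, (sh b).kind = 0)
    (hk2 : ∀ m ∈ merges G, (sh m).kind ≠ 0) (s : ℕ) :
    ∑ w ∈ (form G).filter (fun w => (sh w).step = s), wtPEv (sh w) = (wcntS sh G s : ℝ) := by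
  have hd : Disjoint ((births G).filter fun w => (sh w).step = s) ((merges G).filter fun w => (sh w).step = s) :=
    disjoint_filter_filter (disjoint_births_mergesE W hW)
  rw [form, filter_union, sum_union hd, wcntS]
  have hb : ∑ w ∈ (births G).filter (fun w => (sh w).step = s), wtPEv (sh w) =
      ∑ w ∈ (births G).filter (fun w => (sh w).step = s), (((sh w).fat : ℝ) + 1) :=
    sum_congr rfl fun w hw => by
      have := hk0 w (mem_filter.1 hw).1
      simp [wtPEv, this]
  have hm : ∑ w ∈ (merges G).filter (fun w => (sh w).step = s), wtPEv (sh w) =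
      (((merges G).filter fun w => (sh w).step = s).card : ℝ) := by
    rw [card_eq_sum_ones]
    push_cast
    refine sum_congr rfl fun w hw => ?_
    have := hk2 w (mem_filter.1 hw).1
    simp [wtPEv, this]
  rw [hb, hm]
  push_cast
  ring

/-! ## §2 A dated sub-structure's driver is at most the weighted crowding of the whole -/

/-- **DRIVER ≤ CROWDING (along `sh`).**  If the formation events of `S` are formation events of `G` with shapes dated
no later than `t`, then `qZ (wtPEv ∘ sh) σ (step ∘ sh) S t ≤ Q (wcntS sh G) σ t`. [folklore] -/
theorem qZ_le_QS {G S : Gen ε} (hW : G.WF W) (hk0 : ∀ b ∈ births G, (sh b).kind = 0)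
    (hk2 : ∀ m ∈ merges G, (sh m).kind ≠ 0) {σ : ℝ} (hσ : 0 ≤ σ) (hsub : form S ⊆ form G) {t : ℕ}
    (hdate : ∀ w ∈ form S, (sh w).step ≤ t) :
    qZ (wtPEv ∘ sh) σ (PEv.step ∘ sh) S t ≤ Q (wcntS sh G) σ t := by
  set D := (form G).filter (fun w => (sh w).step ≤ t) with hD
  have hsub' : form S ⊆ D := fun w hw => mem_filter.2 ⟨hsub hw, hdate w hw⟩
  have hmaps : ∀ w ∈ D, (sh w).step ∈ range (t + 1) := fun w hw =>
    mem_range.2 (Nat.lt_succ_of_le (mem_filter.1 hw).2)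
  unfold qZ
  simp only [Function.comp]
  calc ∑ w ∈ form S, wtPEv (sh w) * σ ^ (2 * (t - (sh w).step))
      ≤ ∑ w ∈ D, wtPEv (sh w) * σ ^ (2 * (t - (sh w).step)) :=
        sum_le_sum_of_subset_of_nonneg hsub' fun w _ _ => mul_nonneg (wtPEv_nonneg _) (pow_nonneg hσ _)
    _ = ∑ s ∈ range (t + 1), ∑ w ∈ D.filter (fun w => (sh w).step = s), wtPEv (sh w) * σ ^ (2 * (t - (sh w).step)) :=
        (sum_fiberwise_of_maps_to hmaps _).symm
    _ = ∑ s ∈ range (t + 1), (∑ w ∈ (form G).filter (fun w => (sh w).step = s), wtPEv (sh w)) *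
          σ ^ (2 * (t - s)) := by
        refine sum_congr rfl fun s hs => ?_
        have hs' : s ≤ t := Nat.lt_succ_iff.1 (mem_range.1 hs)
        have hDs : D.filter (fun w => (sh w).step = s) = (form G).filter (fun w => (sh w).step = s) := by
          rw [hD, filter_filter]
          exact filter_congr fun w _ => ⟨fun h => h.2, fun h => ⟨h ▸ hs', h⟩⟩
        rw [hDs, sum_mul]
        exact sum_congr rfl fun w hw => by rw [(mem_filter.1 hw).2]
    _ = Q (wcntS sh G) σ t := by
        unfold Q
        exact sum_congr rfl fun s _ => by rw [sum_wt_filter_eq_wcntS sh W hW hk0 hk2 s]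

/-! ## §3 The structural product of the drivers against the product of crowdings -/

omit [DecidableEq ε] in
/-- formation events of the left partner are formation events of the merger [folklore] -/
theorem form_left_subsetE [DecidableEq ε] (X Y : Gen ε) (e : ε) : form X ⊆ form (Gen.merge X Y e) := fun w hw => by
  simp only [form, births_merge, merges, mem_union, mem_insert] at hw ⊢
  tauto

omit [DecidableEq ε] in
/-- … of the right partner [folklore] -/
theorem form_right_subsetE [DecidableEq ε] (X Y : Gen ε) (e : ε) : form Y ⊆ form (Gen.merge X Y e) := fun w hw => by
  simp only [form, births_merge, merges, mem_union, mem_insert] at hw ⊢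
  tauto

/-- the auxiliary induction over sub-structures `S` of a fixed `G` [folklore] -/
theorem mergeProd_qZ_rpow_le_auxS {G : Gen ε} (hW : G.WF W) (hk0 : ∀ b ∈ births G, (sh b).kind = 0)
    (hk2 : ∀ m ∈ merges G, (sh m).kind ≠ 0) {σ p : ℝ} (hσ : 0 ≤ σ) (hp : 0 ≤ p) :
    ∀ {S : Gen ε}, S.WF W → Chrono (PEv.step ∘ sh) S → form S ⊆ form G →
      mergeProd (fun Z e => qZ (wtPEv ∘ sh) σ (PEv.step ∘ sh) Z (sh e).step ^ p) S ≤
        ∏ e ∈ merges S, Q (wcntS sh G) σ (sh e).step ^ p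
  | Gen.born b j, _, _, _ => by simp [mergeProd, merges]
  | Gen.renew S e h, hS, hc, hsub => by
      simpa [mergeProd, merges] using
        mergeProd_qZ_rpow_le_auxS hW hk0 hk2 hσ hp (S := S) hS.1 hc (by simpa [form, merges] using hsub)
  | Gen.merge X Y e, hS, hc, hsub => by
      obtain ⟨heX, heY, hdM, -⟩ := merge_facts W hS
      obtain ⟨hcX, hcY, hdate⟩ := hc
      have hXY : e ∉ merges X ∪ merges Y := by simp [heX, heY]
      have ihX := mergeProd_qZ_rpow_le_auxS hW hk0 hk2 hσ hp hS.1 hcX ((form_left_subsetE X Y e).trans hsub)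
      have ihY := mergeProd_qZ_rpow_le_auxS hW hk0 hk2 hσ hp hS.2.1 hcY ((form_right_subsetE X Y e).trans hsub)
      have hdate' : ∀ w ∈ form (Gen.merge X Y e), (sh w).step ≤ (sh e).step := by
        intro w hw
        simp only [form, births_merge, merges, mem_union, mem_insert] at hw
        rcases hw with (h | h) | rfl | (h | h)
        · exact hdate w (by simp [form, h])
        · exact hdate w (by simp [form, h])
        · exact le_rfl
        · exact hdate w (by simp [form, h])
        · exact hdate w (by simp [form, h])
      have hq : qZ (wtPEv ∘ sh) σ (PEv.step ∘ sh) (Gen.merge X Y e) (sh e).step ≤ Q (wcntS sh G) σ (sh e).step :=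
        qZ_le_QS sh W hW hk0 hk2 hσ hsub hdate'
      have hq0 : 0 ≤ qZ (wtPEv ∘ sh) σ (PEv.step ∘ sh) (Gen.merge X Y e) (sh e).step :=
        sum_nonneg fun w _ => mul_nonneg (wtPEv_nonneg _) (pow_nonneg hσ _)
      have hqp : qZ (wtPEv ∘ sh) σ (PEv.step ∘ sh) (Gen.merge X Y e) (sh e).step ^ p ≤
          Q (wcntS sh G) σ (sh e).step ^ p := Real.rpow_le_rpow hq0 hq hp
      have hQ0 : ∀ e' : ε, 0 ≤ Q (wcntS sh G) σ (sh e').step ^ p := fun e' =>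
        Real.rpow_nonneg (sum_nonneg fun s _ => mul_nonneg (Nat.cast_nonneg _) (pow_nonneg hσ _)) p
      have hP0 : ∀ s : Finset ε, 0 ≤ ∏ e' ∈ s, Q (wcntS sh G) σ (sh e').step ^ p := fun s =>
        prod_nonneg fun e' _ => hQ0 e'
      have hm0 : ∀ Z : Gen ε, 0 ≤ mergeProd (fun Z e => qZ (wtPEv ∘ sh) σ (PEv.step ∘ sh) Z (sh e).step ^ p) Z :=
        fun Z => mergeProd_nonneg _ (fun _ _ _ => Real.rpow_nonneg
          (sum_nonneg fun w _ => mul_nonneg (wtPEv_nonneg _) (pow_nonneg hσ _)) p) Z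
      rw [mergeProd, merges, prod_insert hXY, prod_union hdM]
      calc mergeProd (fun Z e => qZ (wtPEv ∘ sh) σ (PEv.step ∘ sh) Z (sh e).step ^ p) X *
            mergeProd (fun Z e => qZ (wtPEv ∘ sh) σ (PEv.step ∘ sh) Z (sh e).step ^ p) Y *
            qZ (wtPEv ∘ sh) σ (PEv.step ∘ sh) (Gen.merge X Y e) (sh e).step ^ p
          ≤ (∏ e' ∈ merges X, Q (wcntS sh G) σ (sh e').step ^ p) *
              (∏ e' ∈ merges Y, Q (wcntS sh G) σ (sh e').step ^ p) * Q (wcntS sh G) σ (sh e).step ^ p :=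
            mul_le_mul (mul_le_mul ihX ihY (hm0 Y) (hP0 _)) hqp (Real.rpow_nonneg hq0 p)
              (mul_nonneg (hP0 _) (hP0 _))
        _ = Q (wcntS sh G) σ (sh e).step ^ p * ((∏ e' ∈ merges X, Q (wcntS sh G) σ (sh e').step ^ p) *
              ∏ e' ∈ merges Y, Q (wcntS sh G) σ (sh e').step ^ p) := by
            ring

/-- **THE DRIVERS AGAINST THE CROWDING (along `sh`).**  For `G` well-formed, chronological for `step ∘ sh`, with
kind-`0` birth shapes and non-kind-`0` merger shapes, `p, σ ≥ 0`:
`mergeProd (q_Z^p) G ≤ ∏_{e ∈ merges G} Q(wcntS sh G, σ, (sh e).step)^p`. [folklore] -/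
theorem mergeProd_qZ_rpow_leS {G : Gen ε} (hW : G.WF W) (hk0 : ∀ b ∈ births G, (sh b).kind = 0)
    (hk2 : ∀ m ∈ merges G, (sh m).kind ≠ 0) (hchr : Chrono (PEv.step ∘ sh) G) {σ p : ℝ} (hσ : 0 ≤ σ)
    (hp : 0 ≤ p) :
    mergeProd (fun Z e => qZ (wtPEv ∘ sh) σ (PEv.step ∘ sh) Z (sh e).step ^ p) G ≤
      ∏ e ∈ merges G, Q (wcntS sh G) σ (sh e).step ^ p :=
  mergeProd_qZ_rpow_le_auxS sh W hW hk0 hk2 hσ hp hW hchr subset_rfl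

/-- **COMPOSITE SHAPE (along `sh`)**:
`(M₀(C₀+1)^d)^{mergeCount G}·mergeProd (q_Z^d) G ≤ (M₀(C₀+1)^d)^{#merges G}·∏_{e ∈ merges G} Q(wcntS sh G,σ,(sh e).step)^d`.
[folklore] -/
theorem zoneFactor_le_prod_QS {G : Gen ε} (hW : G.WF W) (hk0 : ∀ b ∈ births G, (sh b).kind = 0)
    (hk2 : ∀ m ∈ merges G, (sh m).kind ≠ 0) (hchr : Chrono (PEv.step ∘ sh) G) {σ M₀ C₀ : ℝ} (hσ : 0 ≤ σ)
    (hM₀ : 0 ≤ M₀) (hC : 0 ≤ C₀) (d : ℕ) :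
    (M₀ * (C₀ + 1) ^ d) ^ mergeCount G *
        mergeProd (fun Z e => qZ (wtPEv ∘ sh) σ (PEv.step ∘ sh) Z ((PEv.step ∘ sh) e) ^ d) G ≤
      (M₀ * (C₀ + 1) ^ d) ^ (merges G).card * ∏ e ∈ merges G, Q (wcntS sh G) σ (sh e).step ^ (d : ℝ) := by
  rw [mergeCount_eq_card W hW]
  refine mul_le_mul_of_nonneg_left ?_ (by positivity)
  have h := mergeProd_qZ_rpow_leS sh W hW hk0 hk2 hchr hσ (Nat.cast_nonneg d)
  have he : mergeProd (fun Z e => qZ (wtPEv ∘ sh) σ (PEv.step ∘ sh) Z ((PEv.step ∘ sh) e) ^ d) G =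
      mergeProd (fun Z e => qZ (wtPEv ∘ sh) σ (PEv.step ∘ sh) Z (sh e).step ^ (d : ℝ)) G := by
    congr 1
    funext Z e
    exact (Real.rpow_natCast _ d).symm
  rw [he]
  exact h

/-! ## §4 The torus joint along a shape map -/

section Torus

variable {d : ℕ}

open scoped Classical

/-- **THE (GM) MULTIPLICITY FACTOR ON THE TORUS, ALONG A SHAPE MAP.**  For `G : Gen ε` well-formed (`W`),
chronological for `step ∘ sh`, with kind-`0` birth shapes and non-kind-`0` merger shapes, events inside `E`, and
nonnegative extents under the affine law `extP t X ≤ C₀·qZ (wtPEv∘sh) σ (step∘sh) X t + c₀` (`C₀, c₀, σ ≥ 0`): the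
zone-admissible torus placements of `grestrict E G hE` with the root piece at `c` number at most
`Kz ^ #merges G · (∏_{e ∈ merges G} Q(wcntS sh G, σ, (sh e).step)^(d:ℝ)) · (L^d) ^ partnerAges (step∘sh) G`,
`Kz = 2^d·(C₀+2c₀+1)^d`. [folklore] -/
theorem card_admZSet_grestrict_leS (n : ℕ) {L : ℕ} (hL : 1 ≤ L) (K : ℕ)
    (extP : ℕ → Gen ε → ℝ) (hext0 : ∀ t X, 0 ≤ extP t X) {C₀ c₀ σ : ℝ} (hC : 0 ≤ C₀) (hc : 0 ≤ c₀)
    (hσ : 0 ≤ σ) (hext : ∀ t X, extP t X ≤ C₀ * qZ (wtPEv ∘ sh) σ (PEv.step ∘ sh) X t + c₀)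
    {G : Gen ε} (hW : G.WF W) (hchr : Chrono (PEv.step ∘ sh) G)
    (hk0 : ∀ b ∈ births G, (sh b).kind = 0) (hk2 : ∀ m ∈ merges G, (sh m).kind ≠ 0)
    (E : Finset ε) (hE : G.events ⊆ E) (c c₀' : TCell d (n * L ^ K)) :
    ((admZSet (nearT n L K) (fun t Z => extP t (gmap Subtype.val Z)) ((PEv.step ∘ sh) ∘ Subtype.val)
        (grestrict E G hE) (grestrict E G hE).root c c₀').card : ℝ) ≤
      ((2 : ℝ) ^ d * (C₀ + 2 * c₀ + 1) ^ d) ^ (merges G).card *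
        (∏ e ∈ merges G, Q (wcntS sh G) σ (sh e).step ^ (d : ℝ)) *
          ((L : ℝ) ^ d) ^ partnerAges (PEv.step ∘ sh) G := by
  set G' := grestrict E G hE with hG'
  have hGG : gmap Subtype.val G' = G := gmap_grestrict E G hE
  have hinj : Function.Injective (Subtype.val : ↥E → ε) := Subtype.val_injective
  have hq : ∀ (Z : Gen ↥E) (t : ℕ), qZ (wtPEv ∘ sh) σ (PEv.step ∘ sh) (gmap Subtype.val Z) t =
      qZ ((wtPEv ∘ sh) ∘ Subtype.val) σ ((PEv.step ∘ sh) ∘ Subtype.val) Z t := fun Z t =>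
    qZ_gmap hinj (wtPEv ∘ sh) σ (PEv.step ∘ sh) Z t
  have hext' : ∀ (t : ℕ) (Z : Gen ↥E), extP t (gmap Subtype.val Z) ≤
      C₀ * qZ ((wtPEv ∘ sh) ∘ Subtype.val) σ ((PEv.step ∘ sh) ∘ Subtype.val) Z t + c₀ := fun t Z => by
    rw [← hq]; exact hext t _
  -- (1) the torus count on the finite alphabet
  have h1 := card_admZSet_root_le_torus (W ∘ Subtype.val) n hL K (fun t Z => extP t (gmap Subtype.val Z))
    (fun t Z => hext0 t _) ((PEv.step ∘ sh) ∘ Subtype.val) hC hc hσ ((wtPEv ∘ sh) ∘ Subtype.val)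
    (fun w => one_le_wtPEv (sh w.1)) hext' (wf_grestrict W E G hE hW) c c₀'
  -- (2) transport of the three structural quantities to `G = gmap val G'`
  have hpa : partnerAges ((PEv.step ∘ sh) ∘ Subtype.val) G' = partnerAges (PEv.step ∘ sh) G := by
    rw [← hGG, partnerAges_gmap]
  have hmc : mergeCount G' = mergeCount G := by rw [← hGG, mergeCount_gmap]
  have hmp : mergeProd (fun Z e => qZ ((wtPEv ∘ sh) ∘ Subtype.val) σ ((PEv.step ∘ sh) ∘ Subtype.val) Z
        (((PEv.step ∘ sh) ∘ Subtype.val) e) ^ d) G' =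
      mergeProd (fun Z e => qZ (wtPEv ∘ sh) σ (PEv.step ∘ sh) Z ((PEv.step ∘ sh) e) ^ d) G := by
    rw [← hGG, mergeProd_gmap]
    congr 1
    funext Z e
    rw [hq]
    rfl
  rw [hpa, hmc, hmp] at h1
  -- (3) the crowding joint along `sh`
  have h2 := zoneFactor_le_prod_QS sh W hW hk0 hk2 hchr hσ (M₀ := (2 : ℝ) ^ d) (C₀ := C₀ + 2 * c₀)
    (by positivity) (by positivity) d
  calc ((admZSet (nearT n L K) (fun t Z => extP t (gmap Subtype.val Z)) ((PEv.step ∘ sh) ∘ Subtype.val)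
          G' G'.root c c₀').card : ℝ)
      ≤ ((L : ℝ) ^ d) ^ partnerAges (PEv.step ∘ sh) G * (((2 : ℝ) ^ d * (C₀ + 2 * c₀ + 1) ^ d) ^ mergeCount G *
          mergeProd (fun Z e => qZ (wtPEv ∘ sh) σ (PEv.step ∘ sh) Z ((PEv.step ∘ sh) e) ^ d) G) := h1
    _ ≤ ((L : ℝ) ^ d) ^ partnerAges (PEv.step ∘ sh) G * (((2 : ℝ) ^ d * (C₀ + 2 * c₀ + 1) ^ d) ^ (merges G).card *
          ∏ e ∈ merges G, Q (wcntS sh G) σ (sh e).step ^ (d : ℝ)) :=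
        mul_le_mul_of_nonneg_left h2 (by positivity)
    _ = _ := by ring

/-- **… WITH THE AFFINE LAW REPLACED BY THE ZONE DYNAMICS** `ZoneDyn (step ∘ sh) (wtPEv ∘ sh) σ Cb ext` (+ `ext ≥ 0`,
`0 ≤ σ < 1`): the bound with `Kz = 2^d(C₀ + 2∕(1−σ²) + 1)^d`, `C₀ = max Cb (1∕(1−σ²)+1)`. [folklore] -/
theorem card_admZSet_grestrict_le_of_dynS (n : ℕ) {L : ℕ} (hL : 1 ≤ L) (K : ℕ)
    (ext : ℕ → Gen ε → ℝ) (hext0 : ∀ t X, 0 ≤ ext t X) {σ Cb : ℝ} (h0 : 0 ≤ σ) (h1 : σ < 1)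
    (dyn : ZoneDyn (PEv.step ∘ sh) (wtPEv ∘ sh) σ Cb ext)
    {G : Gen ε} (hW : G.WF W) (hchr : Chrono (PEv.step ∘ sh) G)
    (hk0 : ∀ b ∈ births G, (sh b).kind = 0) (hk2 : ∀ m ∈ merges G, (sh m).kind ≠ 0)
    (E : Finset ε) (hE : G.events ⊆ E) (c c₀' : TCell d (n * L ^ K)) :
    ((admZSet (nearT n L K) (fun t Z => ext t (gmap Subtype.val Z)) ((PEv.step ∘ sh) ∘ Subtype.val)
        (grestrict E G hE) (grestrict E G hE).root c c₀').card : ℝ) ≤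
      ((2 : ℝ) ^ d * (max Cb (1 / (1 - σ ^ 2) + 1) + 2 * (1 / (1 - σ ^ 2)) + 1) ^ d) ^ (merges G).card *
        (∏ e ∈ merges G, Q (wcntS sh G) σ (sh e).step ^ (d : ℝ)) *
          ((L : ℝ) ^ d) ^ partnerAges (PEv.step ∘ sh) G := by
  have hs1 : σ ^ 2 < 1 := by nlinarith
  have hc0 : 0 < 1 / (1 - σ ^ 2) := by have := sub_pos.2 hs1; positivity
  set C₀ := max Cb (1 / (1 - σ ^ 2) + 1) with hC₀
  have hC : 0 ≤ C₀ := le_max_of_le_right (by linarith)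
  have hlaw := guardExt_le_affine W (fun w => one_le_wtPEv (sh w)) h0 h1 dyn (le_max_left _ _) (le_max_right _ _)
  have hGG : gmap Subtype.val (grestrict E G hE) = G := gmap_grestrict E G hE
  have hset : admZSet (nearT n L K) (fun t Z => ext t (gmap Subtype.val Z)) ((PEv.step ∘ sh) ∘ Subtype.val)
        (grestrict E G hE) (grestrict E G hE).root c c₀' =
      admZSet (nearT n L K) (fun t Z => guardExt W (PEv.step ∘ sh) ext t (gmap Subtype.val Z))
        ((PEv.step ∘ sh) ∘ Subtype.val) (grestrict E G hE) (grestrict E G hE).root c c₀' := by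
    unfold admZSet
    refine filter_congr fun P _ => ?_
    rw [admZ_guard_gmap_iff (nearT n L K) W (PEv.step ∘ sh) ext Subtype.val (by rw [hGG]; exact hW)
      (by rw [hGG]; exact hchr) P]
  rw [hset]
  exact card_admZSet_grestrict_leS sh W n hL K (guardExt W (PEv.step ∘ sh) ext)
    (guardExt_nonneg W (PEv.step ∘ sh) hext0) hC hc0.le h0 hlaw hW hchr hk0 hk2 E hE c c₀'

end Torus

/-! ## §5 Sanity (decided) -/

namespace Sanity

/-- a tagged chain with a REPEATED birth shape: two class-`1` regions born at step `0` (tags `7`, `8`), merged at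
step `1` (tag `9`) [folklore] -/
def twinT : Gen (PEv × ℕ) := Gen.merge (Gen.born ((0, 0, 1), 7) 0) (Gen.born ((0, 0, 1), 8) 0) ((1, 2, 0), 9)

/-- the weighted count along `Prod.fst` sees BOTH births at step `0` (`2 + 2`) and the merger at step `1` -/
example : wcntS Prod.fst twinT 0 = 4 ∧ wcntS Prod.fst twinT 1 = 1 := by decide

/-- the flat image has ONE birth event: its `CrowdingWeighted.wcnt` at step `0` is `2` -/
example : wcnt (gmap Prod.fst twinT) 0 = 2 := by decide

end Sanity

end

end Summit.QuantumFields.BalabanUV.T4Continuum.HistoryZones
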